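import Literature.Geometry.Lorentzian.KerrCylinderParameterClosenessK
import Literature.Geometry.Lorentzian.KerrAxialSymmetryCovariant
import Literature.Geometry.Lorentzian.InteriorKerrGluingReduction
import Literature.Geometry.Lorentzian.KerrCylinderSpinExpansion
import Mathlib.Analysis.InnerProductSpace.Projection.FiniteDimensional
import Mathlib.Analysis.SpecialFunctions.Complex.Arg
import HarnessLib

/-!
# Axial symmetry of the Kerr-cylinder data: the rotation `R` matters only up to rotations
# about the axis

Support file (all results proved; no named facts) for the named fact `LiMei.interiorKerrGluing`
(`InteriorKerrGluing.lean`; J. Li, H. Mei, *A construction of collapsing spacetimes in vacuum*,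
Comm. Math. Phys. 378 (2020) = arXiv:2005.01249, Prop. 4.1). The tree's Kerr-cylinder data
`kerrCylinderDatum m a R` (`KerrCylinderDatum.lean`) are parametrised by a scalar spin `a` and a
linear isometry `R` of `E3` taking the physical axis to the axis `e₃` of the Kerr–Schild charts;
Li–Mei's family is parametrised by the angular-momentum vector `a⃗` (`(m, a⃗) ∈ ℝ⁴`, p. 22:
"for an arbitrary vector `a⃗ ∈ ℝ³` with `|a⃗| = a` and an isometry `Ω_{a⃗} ∈ SO(3)` mapping `a⃗` to
`(0, 0, a)`, define the Kerr metric `g_{m,a⃗} = (id_ℝ × Ω_{a⃗})^* g_{m,a}` … Because of the axial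
symmetry of the Kerr metric, this definition does not depend on the choice of `Ω_{a⃗}`"). This file
proves exactly that independence for the tree's cylinder data, from the covariant axial symmetry
of the Kerr–Schild metric (`Kerr.bilin_axialRotation`) through the closed forms of the two
fields:

* `E3.axialRot α` — the rotation about `e₃` of `E3`, with `(0, S_α y) = R_α (0, y)`
  (`E3.ofTimeSpace_axialRot`) for the rotation `R_α = E4.axialRotation α` of the chart;
* equivariance of the cylinder map, `ψ[S_α ∘ R] = R_α ∘ ψ[R]` (`kerrCylMap_axialRot`), of its
  differential, of `∇r`, `g♯dr` and the unit normal (`Kerr.radiusGradVec_axialRot`,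
  `Kerr.radiusSharp_axialRotation`, `kerrCylUnitNormal_axialRotation`), and of the metric
  derivative (`Kerr.fderiv_bilin_axialRotation`);
* invariance of the pulled-back metric `H₀` (`cylH₀_axialRot`), of the closed form of the second
  fundamental form and of `K` (`cylKRep_axialRot`, `cylK₀_axialRot`), hence of both fields of the
  datum: `kerrCylinderDatum_h_inner_axialRot`, `kerrCylinderDatum_k_axialRot`;
* `E3.exists_eq_axialRot` — an orientation-preserving linear isometry of `E3` fixing `e₃` is an
  `S_α`; hence (`kerrCylinderDatum_h_inner_eq_of_apply_eq`, `kerrCylinderDatum_k_eq_of_apply_eq`)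
  **two orientation-preserving `R, R'` sending the same unit vector to `e₃` give the same datum**,
  and `LiMei.det_spinIsometry` — the rotations `spinIsometry a⃗` of
  `InteriorKerrGluingReduction.lean` are orientation preserving: the family
  `kerrCylinderDatum m ‖a⃗‖ (spinIsometry a⃗)` is the canonical one (depends on `a⃗` only through
  the physical angular-momentum direction); `contDiffOn_spinIsometry` — `a⃗ ↦ spinIsometry a⃗` is
  smooth off `0` and the upward axis ray (an explicit chart of `SO(3)`); `spinIsometry₂`,
  `contDiffOn_spinIsometry₂`, `kerrCylinderDatum_h_inner_spinIsometry₂` — a second chart, smooth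
  across the upward ray, giving the same data: together, the family is given by smooth charts
  near every `a⃗ ≠ 0`;
* `hasDerivAt_cylH₀_spin_isometry` — the first-order spin term of the metric (Li–Mei (4.2),
  `KerrCylinderSpinExpansion.lean`) for a rotated axis.
* `spinIsometry_apply_of_not`, `contDiffOn_spinIsometry_apply` — the explicit formula and joint
  smoothness of `(a⃗, y) ↦ spinIsometry a⃗ y` off the positive axis; `spinIsometry'` — a second
  chart of rotations smooth across the positive axis (`contDiffOn_spinIsometry'_apply`), giving
  the same data (`kerrCylinderDatum_h_inner_spinIsometry'`, `kerrCylinderDatum_k_spinIsometry'`):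
  together, the family `a⃗ ↦ kerrCylinderDatum m ‖a⃗‖ (spinIsometry a⃗)` is smooth on `a⃗ ≠ 0`
  (its behaviour at `a⃗ = 0` is governed by the closeness estimates of
  `KerrCylinderParameterClosenessK.lean`).

## References

* J. Li, H. Mei, *A construction of collapsing spacetimes in vacuum*, Comm. Math. Phys. 378
  (2020), arXiv:2005.01249, §4, p. 22 (the family `g_{m,a⃗}` and its independence of `Ω_{a⃗}`)
  and p. 25 (key `LiMei2020`).
* B. O'Neill, *The geometry of Kerr black holes*, 1995, Ch. 2, §2.2 (axial symmetry)
  (key `ONeill1995`).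
-/

noncomputable section

open Set Metric Filter Function
open scoped Manifold ContDiff Topology RealInnerProductSpace

namespace Literature.Geometry.Lorentzian

/-! ### Shortcut instances

As in `KerrCylinderParameterCloseness.lean`: typeclass synthesis on the normed spaces of
multilinear forms is slow in this import closure; the shortcuts are the canonical instances. -/

attribute [local instance] instNormedAddCommGroupBilinE3 instNormedSpaceBilinE3
  instNormedAddCommGroupBilinE4 instNormedSpaceBilinE4 instNormedAddCommGroupTrilinE4
  instNormedSpaceTrilinE4

/-! ### The rotation about the axis of `E3` -/

namespace E3

/-- The underlying linear map of the rotation by `α` about `e₃`. [folklore] -/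
def axialRotLin (α : ℝ) : E3 →ₗ[ℝ] E3 where
  toFun y := WithLp.toLp 2 ![Real.cos α * y 0 - Real.sin α * y 1,
    Real.sin α * y 0 + Real.cos α * y 1, y 2]
  map_add' y y' := by
    ext i
    fin_cases i <;> simp <;> ring
  map_smul' c y := by
    ext i
    fin_cases i <;> simp <;> ring

/-- The rotation preserves the norm. [folklore] -/
theorem norm_axialRotLin (α : ℝ) (y : E3) : ‖axialRotLin α y‖ = ‖y‖ := by
  have h1 : ‖axialRotLin α y‖ ^ 2 = ‖y‖ ^ 2 := by
    rw [EuclideanSpace.real_norm_sq_eq, EuclideanSpace.real_norm_sq_eq, Fin.sum_univ_three,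
      Fin.sum_univ_three]
    simp only [axialRotLin, LinearMap.coe_mk, AddHom.coe_mk, PiLp.toLp_apply,
      Matrix.cons_val_zero, Matrix.cons_val_one, Matrix.cons_val]
    have h := Real.sin_sq_add_cos_sq α
    linear_combination (y 0 ^ 2 + y 1 ^ 2) * h
  nlinarith [norm_nonneg (axialRotLin α y), norm_nonneg y]

/-- **The rotation `S_α` by the angle `α` about the axis `e₃` of `E3`**, a linear isometry.
O'Neill 1995, Ch. 2, §2.2. [cite: ONeill1995, Ch. 2 §2.2] -/
def axialRot (α : ℝ) : E3 →ₗᵢ[ℝ] E3 :=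
  ⟨axialRotLin α, norm_axialRotLin α⟩

/-- Component `0`. [folklore] -/
@[simp]
theorem axialRot_apply_zero (α : ℝ) (y : E3) :
    axialRot α y 0 = Real.cos α * y 0 - Real.sin α * y 1 := rfl

/-- Component `1`. [folklore] -/
@[simp]
theorem axialRot_apply_one (α : ℝ) (y : E3) :
    axialRot α y 1 = Real.sin α * y 0 + Real.cos α * y 1 := rfl

/-- Component `2` is invariant. [folklore] -/
@[simp]
theorem axialRot_apply_two (α : ℝ) (y : E3) : axialRot α y 2 = y 2 := rfl

/-- **`(t, S_α y) = R_α (t, y)`**: the rotation of `E3` is the spatial part of the rotation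
`E4.axialRotation α` of the chart. [folklore] -/
theorem ofTimeSpace_axialRot (α t : ℝ) (y : E3) :
    E4.ofTimeSpace t (axialRot α y) = E4.axialRotation α (E4.ofTimeSpace t y) := by
  ext i
  fin_cases i <;> rfl

/-- `(0, S_α y) = R_α (0, y)` for the linear embedding. [folklore] -/
theorem spaceEmbed_axialRot (α : ℝ) (y : E3) :
    E4.spaceEmbed (axialRot α y) = E4.axialRotation α (E4.spaceEmbed y) :=
  ofTimeSpace_axialRot α 0 y

/-- `spatial (R_α x) = S_α (spatial x)`. [folklore] -/
theorem spatial_axialRotation (α : ℝ) (x : E4) :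
    E4.spatial (E4.axialRotation α x) = axialRot α (E4.spatial x) := by
  ext i
  fin_cases i <;> rfl

/-- The rotation fixes `e₃`. [folklore] -/
@[simp]
theorem axialRot_single_two (α : ℝ) (c : ℝ) :
    axialRot α (EuclideanSpace.single 2 c) = EuclideanSpace.single 2 c := by
  ext i
  fin_cases i <;> simp

end E3

namespace LiMei

/-! ### Equivariance of the cylinder map and of its differential -/

/-- The ellipsoid matrix `diag(√(r₀² + a²), √(r₀² + a²), r₀)` commutes with the rotations about
`e₃`. [folklore] -/
theorem ellipsoidCLM_axialRot (r₀ a α : ℝ) (n : E3) :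
    ellipsoidCLM r₀ a (E3.axialRot α n) = E3.axialRot α (ellipsoidCLM r₀ a n) := by
  ext i
  fin_cases i <;> simp [ellipsoidCLM_apply, ellipsoidPt] <;> ring

/-- **Equivariance of the Kerr cylinder map**: `ψ[S_α ∘ R](y) = R_α (ψ[R](y))`.
[cite: LiMei2020, §4, p. 22] -/
theorem kerrCylMap_axialRot (r₀ a τ₀ α : ℝ) (R : E3 →ₗᵢ[ℝ] E3) (y : E3) :
    kerrCylMap r₀ a τ₀ ((E3.axialRot α).comp R) y = E4.axialRotation α (kerrCylMap r₀ a τ₀ R y) := by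
  rw [kerrCylMap_eq, kerrCylMap_eq, map_add, (E4.axialRotation α).map_smul,
    E4.axialRotation_basisVector_zero, ← E3.spaceEmbed_axialRot, ← ellipsoidCLM_axialRot]
  rfl

/-- **Equivariance of the differential**: `dψ[S_α ∘ R]_y = R_α ∘ dψ[R]_y` (`y ≠ 0`). [folklore] -/
theorem kerrCylDeriv_axialRot (r₀ a α : ℝ) (R : E3 →ₗᵢ[ℝ] E3) {y : E3} (hy : y ≠ 0) :
    kerrCylDeriv r₀ a ((E3.axialRot α).comp R) y =
      (E4.axialRotation α).comp (kerrCylDeriv r₀ a R y) := by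
  have h1 := hasFDerivAt_kerrCylMap r₀ a 0 ((E3.axialRot α).comp R) hy
  have e : kerrCylMap r₀ a 0 ((E3.axialRot α).comp R) =
      E4.axialRotation α ∘ kerrCylMap r₀ a 0 R := funext (kerrCylMap_axialRot r₀ a 0 α R)
  rw [e] at h1
  exact h1.unique ((E4.axialRotation α).hasFDerivAt.comp y (hasFDerivAt_kerrCylMap r₀ a 0 R hy))

/-- **The pulled-back metric does not see rotations about the axis**:
`H₀[m, a, S_α ∘ R](y) = H₀[m, a, R](y)` (`y ≠ 0`; covariant axial symmetry
`Kerr.bilin_axialRotation`). [cite: ONeill1995, Ch. 2 §2.2] -/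
theorem cylH₀_axialRot (m a r₀ τ₀ α : ℝ) (R : E3 →ₗᵢ[ℝ] E3) {y : E3} (hy : y ≠ 0) :
    cylH₀ m a r₀ τ₀ ((E3.axialRot α).comp R) y = cylH₀ m a r₀ τ₀ R y := by
  ext v w
  rw [cylH₀_apply, cylH₀_apply, kerrCylDeriv_axialRot r₀ a α R hy, kerrCylMap_axialRot]
  simp only [ContinuousLinearMap.comp_apply]
  exact Kerr.bilin_axialRotation m a α _ _ _

end LiMei

/-! ### Equivariance of `∇r`, `g♯dr`, the unit normal and the metric derivative -/

namespace Kerr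

/-- `∇r(a, S_α y) = S_α ∇r(a, y)`. [folklore] -/
theorem radiusGradVec_axialRot (a α : ℝ) (y : E3) :
    radiusGradVec a (E3.axialRot α y) = E3.axialRot α (radiusGradVec a y) := by
  have hr : radius a (E4.ofTimeSpace 0 (E3.axialRot α y)) = radius a (E4.ofTimeSpace 0 y) := by
    rw [E3.ofTimeSpace_axialRot, radius_axialRotation]
  have hS : blSigma a (E3.axialRot α y) = blSigma a y := by
    unfold blSigma
    rw [hr, (E3.axialRot α).norm_map]
  unfold radiusGradVec
  rw [hr, hS, E3.axialRot_apply_two, map_smul, map_add, map_smul, map_smul, E3.axialRot_single_two]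

/-- **`g♯dr` is equivariant**: `(g♯dr)(R_α x) = R_α (g♯dr)(x)`. [folklore] -/
theorem radiusSharp_axialRotation (M a α : ℝ) (x : E4) :
    radiusSharp M a (E4.axialRotation α x) = E4.axialRotation α (radiusSharp M a x) := by
  unfold radiusSharp
  rw [E3.spatial_axialRotation, radiusGradVec_axialRot, E3.spaceEmbed_axialRot,
    scalarH_axialRotation, nullVector_axialRotation, map_sub, map_smul]

/-- Evaluation of a bilinear form on `E4` at `(u, v)`, as a continuous linear functional.
[folklore] -/
def evalForm (u v : E4) : (E4 →L[ℝ] E4 →L[ℝ] ℝ) →L[ℝ] ℝ :=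
  (ContinuousLinearMap.apply ℝ ℝ v).comp (ContinuousLinearMap.apply ℝ (E4 →L[ℝ] ℝ) u)

/-- `evalForm u v T = T u v`. [folklore] -/
@[simp]
theorem evalForm_apply (u v : E4) (T : E4 →L[ℝ] E4 →L[ℝ] ℝ) : evalForm u v T = T u v := rfl

/-- **The derivative of the Kerr–Schild metric is equivariant**:
`Dg(R_α x)(R_α w)(R_α u, R_α v) = Dg(x)(w)(u, v)` wherever `r > 0` (differentiate the covariant
axial symmetry `g(R_α x)(R_α u, R_α v) = g(x)(u, v)` in `x`). [cite: ONeill1995, Ch. 2 §2.2] -/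
theorem fderiv_bilin_axialRotation (M a α : ℝ) {x : E4} (hx : 0 < radius a x) (w u v : E4) :
    fderiv ℝ (bilin M a) (E4.axialRotation α x) (E4.axialRotation α w) (E4.axialRotation α u)
      (E4.axialRotation α v) = fderiv ℝ (bilin M a) x w u v := by
  set A : E4 →L[ℝ] E4 := E4.axialRotation α with hA
  have hxA : 0 < radius a (A x) := by rw [hA, radius_axialRotation]; exact hx
  have hG : HasFDerivAt (bilin M a) (fderiv ℝ (bilin M a) (A x)) (A x) :=
    ((contDiffAt_bilin M a hxA (n := 1)).differentiableAt one_ne_zero).hasFDerivAt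
  have hG₀ : HasFDerivAt (bilin M a) (fderiv ℝ (bilin M a) x) x :=
    ((contDiffAt_bilin M a hx (n := 1)).differentiableAt one_ne_zero).hasFDerivAt
  -- both sides are derivatives of the same scalar function `x ↦ g(x)(u, v)`
  have hGA : HasFDerivAt (bilin M a ∘ A) ((fderiv ℝ (bilin M a) (A x)).comp A) x :=
    hG.comp x A.hasFDerivAt
  have h1 : HasFDerivAt (evalForm (A u) (A v) ∘ (bilin M a ∘ A))
      ((evalForm (A u) (A v)).comp ((fderiv ℝ (bilin M a) (A x)).comp A)) x :=
    (evalForm (A u) (A v)).hasFDerivAt.comp x hGA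
  have h2 : HasFDerivAt (evalForm u v ∘ bilin M a)
      ((evalForm u v).comp (fderiv ℝ (bilin M a) x)) x :=
    (evalForm u v).hasFDerivAt.comp x hG₀
  have e : evalForm (A u) (A v) ∘ (bilin M a ∘ A) = evalForm u v ∘ bilin M a := by
    funext x'
    simp only [comp_apply, evalForm_apply, hA]
    exact bilin_axialRotation M a α x' u v
  rw [e] at h1
  have h := congrArg (fun T : E4 →L[ℝ] ℝ ↦ T w) (h1.unique h2)
  simpa only [ContinuousLinearMap.comp_apply, evalForm_apply] using h

end Kerr

namespace LiMei

/-- **The unit normal field is equivariant**: `n_{m,a}(R_α x) = R_α n_{m,a}(x)`. [folklore] -/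
theorem kerrCylUnitNormal_axialRotation (m a α : ℝ) (x : E4) :
    kerrCylUnitNormal m a (E4.axialRotation α x) = E4.axialRotation α (kerrCylUnitNormal m a x) := by
  unfold kerrCylUnitNormal
  rw [Kerr.radiusSharp_axialRotation, Kerr.bilin_axialRotation, map_smul]

/-- **The closed form of the second fundamental form does not see rotations about the axis**
(`Δ_{m,a}(r₀) < 0`, `0 < r₀`, `y ≠ 0`). [cite: ONeill1995, Ch. 2 §2.2] -/
theorem cylKRep_axialRot {m a r₀ : ℝ} (hr₀ : 0 < r₀) (hΔ : r₀ ^ 2 - 2 * m * r₀ + a ^ 2 < 0)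
    (τ₀ α : ℝ) (R : E3 →ₗᵢ[ℝ] E3) {y : E3} (hy : y ≠ 0) (v w : E3) :
    cylKRep m a r₀ τ₀ ((E3.axialRot α).comp R) y v w = cylKRep m a r₀ τ₀ R y v w := by
  set A : E4 →L[ℝ] E4 := E4.axialRotation α with hA
  have hx : 0 < Kerr.radius a (kerrCylMap r₀ a τ₀ R y) := by
    rw [radius_kerrCylMap hr₀.le a τ₀ R hy]; exact hr₀
  -- the normal field along `ψ[S_α ∘ R]` is `R_α ∘ (n ∘ ψ[R])`
  have hN : (fun z : E3 ↦ kerrCylUnitNormal m a (kerrCylMap r₀ a τ₀ ((E3.axialRot α).comp R) z)) =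
      A ∘ fun z : E3 ↦ kerrCylUnitNormal m a (kerrCylMap r₀ a τ₀ R z) := by
    funext z
    simp only [comp_apply, kerrCylMap_axialRot, kerrCylUnitNormal_axialRotation, hA]
  have hdiff : DifferentiableAt ℝ (fun z : E3 ↦ kerrCylUnitNormal m a (kerrCylMap r₀ a τ₀ R z)) y :=
    ((contDiffAt_kerrCylUnitNormal hx (bilin_radiusSharp_self_neg_of_delta_neg hr₀ hΔ τ₀ R hy)
      (n := 1)).comp y (contDiffAt_kerrCylMap r₀ a τ₀ R hy)).differentiableAt one_ne_zero
  have hD : fderiv ℝ (fun z : E3 ↦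
      kerrCylUnitNormal m a (kerrCylMap r₀ a τ₀ ((E3.axialRot α).comp R) z)) y =
      A.comp (fderiv ℝ (fun z : E3 ↦ kerrCylUnitNormal m a (kerrCylMap r₀ a τ₀ R z)) y) := by
    rw [hN]
    exact (A.hasFDerivAt.comp y hdiff.hasFDerivAt).fderiv
  unfold cylKRep
  rw [hD, kerrCylDeriv_axialRot r₀ a α R hy, kerrCylMap_axialRot, kerrCylUnitNormal_axialRotation]
  simp only [ContinuousLinearMap.comp_apply, ← hA]
  rw [Kerr.bilin_axialRotation, hA, Kerr.fderiv_bilin_axialRotation m a α hx,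
    Kerr.fderiv_bilin_axialRotation m a α hx, Kerr.fderiv_bilin_axialRotation m a α hx]

/-- **The second fundamental form of the Kerr cylinder does not see rotations about the axis**
(`Δ_{m,a}(r₀) < 0`). [cite: ONeill1995, Ch. 2 §2.2] -/
theorem cylK₀_axialRot [Kerr.Facts] {m a r₀ : ℝ} (hr₀ : 0 < r₀)
    (hΔ : r₀ ^ 2 - 2 * m * r₀ + a ^ 2 < 0) (τ₀ α : ℝ) (R : E3 →ₗᵢ[ℝ] E3) {y : E3} (hy : y ≠ 0) :
    cylK₀ m a hr₀ τ₀ ((E3.axialRot α).comp R) y = cylK₀ m a hr₀ τ₀ R y := by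
  ext v w
  rw [cylK₀_apply_eq_cylKRep hr₀ hΔ τ₀ _ hy, cylK₀_apply_eq_cylKRep hr₀ hΔ τ₀ R hy,
    cylKRep_axialRot hr₀ hΔ τ₀ α R hy]

/-! ### The datum -/

/-- **The metric of the Kerr-cylinder datum does not see rotations about the axis**:
`h[m, a, S_α ∘ R] = h[m, a, R]` — the rotation `R` matters only through the axis `R⁻¹ e₃`
(Li–Mei p. 22: "because of the axial symmetry of the Kerr metric, this definition does not depend
on the choice of `Ω_{a⃗}`"). [cite: LiMei2020, §4, p. 22] -/
theorem kerrCylinderDatum_h_inner_axialRot [Kerr.Facts] {m a r₀ : ℝ} (ha : |a| < m)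
    (h₁ : Kerr.rMinus m a < r₀) (h₂ : r₀ < Kerr.rPlus m a) (τ₀ α : ℝ) (R : E3 →ₗᵢ[ℝ] E3) (y : E3) :
    (kerrCylinderDatum ha h₁ h₂ τ₀ ((E3.axialRot α).comp R)).h.inner y =
      (kerrCylinderDatum ha h₁ h₂ τ₀ R).h.inner y := by
  rw [kerrCylinderDatum_h_inner, kerrCylinderDatum_h_inner]
  ext v w
  rw [cylH_apply, cylH_apply]
  by_cases hy : y = 0
  · rw [cylCutoff_of_norm_le (by rw [hy, norm_zero]; norm_num)]
    ring
  · rw [cylH₀_axialRot m a r₀ τ₀ α R hy]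

/-- **The second fundamental form of the Kerr-cylinder datum does not see rotations about the
axis**: `k[m, a, S_α ∘ R] = k[m, a, R]`. [cite: LiMei2020, §4, p. 22] -/
theorem kerrCylinderDatum_k_axialRot [Kerr.Facts] {m a r₀ : ℝ} (ha : |a| < m)
    (h₁ : Kerr.rMinus m a < r₀) (h₂ : r₀ < Kerr.rPlus m a) (τ₀ α : ℝ) (R : E3 →ₗᵢ[ℝ] E3) (y : E3) :
    (kerrCylinderDatum ha h₁ h₂ τ₀ ((E3.axialRot α).comp R)).k y =
      (kerrCylinderDatum ha h₁ h₂ τ₀ R).k y := by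
  rw [kerrCylinderDatum_k, kerrCylinderDatum_k]
  ext v w
  rw [cylK_apply, cylK_apply]
  by_cases hy : y = 0
  · rw [cylCutoff_of_norm_le (by rw [hy, norm_zero]; norm_num)]
    ring
  · rw [cylK₀_axialRot (pos_of_rMinus_lt ha h₁) (Kerr.delta_neg ha.le h₁ h₂) τ₀ α R hy]

/-! ### Orientation-preserving isometries fixing the axis are the `S_α` -/

end LiMei

namespace E3

/-- A vector of `E3` in the standard basis. [folklore] -/
theorem eq_sum_single (y : E3) :
    y = y 0 • EuclideanSpace.single 0 1 + y 1 • EuclideanSpace.single 1 1 +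
      y 2 • EuclideanSpace.single 2 1 := by
  ext i
  fin_cases i <;> simp

/-- **An orientation-preserving linear isometry of `E3` fixing the axis `e₃` is a rotation `S_α`
about it.** (Its matrix has columns `u = S e₁ ⊥ e₃`, `w = S e₂ ⊥ e₃, u`, unit, and
`det = u₀w₁ − u₁w₀ = 1` forces `w = (−u₁, u₀, 0)`; `α = arg(u₀ + i u₁)`.) [folklore] -/
theorem exists_eq_axialRot (S : E3 →ₗᵢ[ℝ] E3)
    (h3 : S (EuclideanSpace.single 2 1) = EuclideanSpace.single 2 1)
    (hdet : LinearMap.det S.toLinearMap = 1) : ∃ α : ℝ, S = axialRot α := by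
  have inner_eq_sum_three : ∀ x z : E3, ⟪x, z⟫ = x 0 * z 0 + x 1 * z 1 + x 2 * z 2 :=
    fun x z ↦ by
      rw [PiLp.inner_apply, Fin.sum_univ_three]
      simp only [RCLike.inner_apply, conj_trivial]
      ring
  set u : E3 := S (EuclideanSpace.single 0 1) with hu
  set w : E3 := S (EuclideanSpace.single 1 1) with hw
  -- orthonormality relations
  have huu : u 0 * u 0 + u 1 * u 1 + u 2 * u 2 = 1 := by
    have h := S.inner_map_map (EuclideanSpace.single 0 1) (EuclideanSpace.single 0 1)
    rw [inner_eq_sum_three] at h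
    rw [← hu] at h
    rw [h]; simp
  have hww : w 0 * w 0 + w 1 * w 1 + w 2 * w 2 = 1 := by
    have h := S.inner_map_map (EuclideanSpace.single 1 1) (EuclideanSpace.single 1 1)
    rw [inner_eq_sum_three] at h
    rw [← hw] at h
    rw [h]; simp
  have huw : u 0 * w 0 + u 1 * w 1 + u 2 * w 2 = 0 := by
    have h := S.inner_map_map (EuclideanSpace.single 0 1) (EuclideanSpace.single 1 1)
    rw [inner_eq_sum_three] at h
    rw [← hu, ← hw] at h
    rw [h]; simp [EuclideanSpace.inner_single_left]
  have hu2 : u 2 = 0 := by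
    have h := S.inner_map_map (EuclideanSpace.single 0 1) (EuclideanSpace.single 2 1)
    rw [inner_eq_sum_three, h3] at h
    rw [← hu] at h
    simpa [EuclideanSpace.inner_single_left] using h
  have hw2 : w 2 = 0 := by
    have h := S.inner_map_map (EuclideanSpace.single 1 1) (EuclideanSpace.single 2 1)
    rw [inner_eq_sum_three, h3] at h
    rw [← hw] at h
    simpa [EuclideanSpace.inner_single_left] using h
  -- the determinant in the standard basis
  have hd : u 0 * w 1 - u 1 * w 0 = 1 := by
    have e := LinearMap.det_toMatrix (EuclideanSpace.basisFun (Fin 3) ℝ).toBasis S.toLinearMap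
    rw [hdet, Matrix.det_fin_three] at e
    simp only [LinearMap.toMatrix_apply, OrthonormalBasis.coe_toBasis, EuclideanSpace.basisFun_apply,
      OrthonormalBasis.coe_toBasis_repr_apply, EuclideanSpace.basisFun_repr,
      LinearIsometry.coe_toLinearMap] at e
    rw [h3, ← hu, ← hw, hu2, hw2] at e
    simp at e
    linarith
  -- `w = (−u₁, u₀, 0)`
  have huu' : u 0 * u 0 + u 1 * u 1 = 1 := by rw [hu2] at huu; linarith
  have huw' : u 0 * w 0 + u 1 * w 1 = 0 := by rw [hu2, hw2] at huw; linarith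
  have hw0 : w 0 = -u 1 := by linear_combination u 0 * huw' - u 1 * hd - w 0 * huu'
  have hw1 : w 1 = u 0 := by linear_combination u 1 * huw' + u 0 * hd - w 1 * huu'
  -- the angle
  set z : ℂ := ⟨u 0, u 1⟩ with hz
  have hz1 : ‖z‖ = 1 := by
    have h2 : ‖z‖ ^ 2 = 1 := by
      rw [Complex.sq_norm, Complex.normSq_apply]
      simpa using huu'
    nlinarith [norm_nonneg z]
  have hz0 : z ≠ 0 := by
    intro h; rw [h, norm_zero] at hz1; exact zero_ne_one hz1
  refine ⟨Complex.arg z, ?_⟩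
  have hc : Real.cos (Complex.arg z) = u 0 := by rw [Complex.cos_arg hz0, hz1, div_one]
  have hs : Real.sin (Complex.arg z) = u 1 := by rw [Complex.sin_arg, hz1, div_one]
  apply LinearIsometry.ext
  intro y
  have hy : S y = y 0 • u + y 1 • w + y 2 • EuclideanSpace.single 2 1 := by
    conv_lhs => rw [eq_sum_single y]
    rw [map_add, map_add, map_smul, map_smul, map_smul, h3]
  ext i
  rw [hy]
  fin_cases i
  · simp [hc, hs, hw0]; ring
  · simp [hc, hs, hw1]; ring
  · simp [hu2, hw2]

/-- Two orientation-preserving linear isometries of `E3` sending the same vector `n ≠ 0`… more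
precisely with `T n = e₃ = T' n`, differ by a rotation about the axis: `T' = S_α ∘ T`.
[folklore] -/
theorem exists_eq_axialRot_comp {T T' : E3 →ₗᵢ[ℝ] E3} {n : E3}
    (hT : T n = EuclideanSpace.single 2 1) (hT' : T' n = EuclideanSpace.single 2 1)
    (hdT : LinearMap.det T.toLinearMap = 1) (hdT' : LinearMap.det T'.toLinearMap = 1) :
    ∃ α : ℝ, T' = (axialRot α).comp T := by
  set e : E3 ≃ₗᵢ[ℝ] E3 := T.toLinearIsometryEquiv rfl with he
  have heT : ∀ y, e y = T y := fun y ↦ rfl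
  set S : E3 →ₗᵢ[ℝ] E3 := T'.comp e.symm.toLinearIsometry with hS
  have hSe : ∀ y, S (T y) = T' y := fun y ↦ by
    show T' (e.symm (T y)) = T' y
    rw [← heT, e.symm_apply_apply]
  have h3 : S (EuclideanSpace.single 2 1) = EuclideanSpace.single 2 1 := by
    calc S (EuclideanSpace.single 2 1) = S (T n) := by rw [hT]
      _ = T' n := hSe n
      _ = EuclideanSpace.single 2 1 := hT'
  have hdet : LinearMap.det S.toLinearMap = 1 := by
    have hcomp : S.toLinearMap = T'.toLinearMap ∘ₗ (e.symm.toLinearEquiv : E3 →ₗ[ℝ] E3) := rfl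
    have hdete : LinearMap.det (e.toLinearEquiv : E3 →ₗ[ℝ] E3) = 1 := hdT
    rw [hcomp, LinearMap.det_comp, hdT', one_mul]
    rw [show (e.symm.toLinearEquiv : E3 →ₗ[ℝ] E3) = ((e.toLinearEquiv).symm : E3 →ₗ[ℝ] E3) from rfl,
      LinearEquiv.det_coe_symm, hdete, inv_one]
  obtain ⟨α, hα⟩ := exists_eq_axialRot S h3 hdet
  refine ⟨α, LinearIsometry.ext fun y ↦ ?_⟩
  rw [LinearIsometry.coe_comp, Function.comp_apply, ← hSe, hα]

end E3

namespace LiMei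

/-- **The rotations `spinIsometry a⃗` are orientation preserving** (identity, or a product of two
hyperplane reflections, each of determinant `−1`: `Submodule.det_reflection`) — they are
admissible choices of Li–Mei's `Ω_{a⃗} ∈ SO(3)`. [cite: LiMei2020, §4, p. 22] -/
theorem det_spinIsometry (b : E3) : LinearMap.det (spinIsometry b).toLinearMap = 1 := by
  unfold spinIsometry
  split_ifs with h
  · exact LinearMap.det_id
  · have hb : b ≠ 0 := fun hb ↦ h (Or.inl hb)
    have hv : ‖b‖⁻¹ • b - axisVec ≠ 0 := fun hv ↦ h (Or.inr (sub_eq_zero.1 hv))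
    have hs : sideVec ≠ 0 := by
      intro h0
      have := congrArg (fun v : E3 ↦ v 0) h0
      simp [sideVec] at this
    have hrank : ∀ {v : E3}, v ≠ 0 → Module.finrank ℝ (ℝ ∙ v)ᗮᗮ = 1 := fun {v} hv ↦ by
      rw [Submodule.orthogonal_orthogonal, finrank_span_singleton hv]
    show LinearMap.det (((ℝ ∙ (‖b‖⁻¹ • b - axisVec))ᗮ.reflection.trans
      (ℝ ∙ sideVec)ᗮ.reflection).toLinearIsometry).toLinearMap = 1
    have hcomp : (((ℝ ∙ (‖b‖⁻¹ • b - axisVec))ᗮ.reflection.trans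
        (ℝ ∙ sideVec)ᗮ.reflection).toLinearIsometry).toLinearMap =
        ((ℝ ∙ sideVec)ᗮ.reflection.toLinearEquiv : E3 →ₗ[ℝ] E3) ∘ₗ
          ((ℝ ∙ (‖b‖⁻¹ • b - axisVec))ᗮ.reflection.toLinearEquiv : E3 →ₗ[ℝ] E3) := rfl
    rw [hcomp, LinearMap.det_comp]
    have h1 := (ℝ ∙ sideVec)ᗮ.det_reflection
    have h2 := (ℝ ∙ (‖b‖⁻¹ • b - axisVec))ᗮ.det_reflection
    rw [hrank hs] at h1
    rw [hrank hv] at h2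
    rw [show ((ℝ ∙ sideVec)ᗮ.reflection.toLinearEquiv : E3 →ₗ[ℝ] E3) =
      (ℝ ∙ sideVec)ᗮ.reflection.toLinearMap from rfl, h1,
      show ((ℝ ∙ (‖b‖⁻¹ • b - axisVec))ᗮ.reflection.toLinearEquiv : E3 →ₗ[ℝ] E3) =
      (ℝ ∙ (‖b‖⁻¹ • b - axisVec))ᗮ.reflection.toLinearMap from rfl, h2]
    norm_num

/-- The set of directions where the explicit two-reflection formula for `spinIsometry` applies:
`a⃗ ≠ 0` not on the positive axis. It is open. [folklore] -/
theorem isOpen_spinIsometry_good :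
    IsOpen {b : E3 | ¬(b = 0 ∨ ‖b‖⁻¹ • b = axisVec)} := by
  have h1 : IsOpen {b : E3 | b ≠ 0} := isOpen_ne
  have hc : ContinuousOn (fun b : E3 ↦ ‖b‖⁻¹ • b) {b : E3 | b ≠ 0} :=
    (continuous_norm.continuousOn.inv₀ fun b hb ↦ norm_ne_zero_iff.2 hb).smul continuousOn_id
  have h2 : IsOpen {b ∈ {b : E3 | b ≠ 0} | ‖b‖⁻¹ • b ∈ ({axisVec}ᶜ : Set E3)} :=
    hc.isOpen_inter_preimage h1 isOpen_compl_singleton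
  convert h2 using 1
  ext b
  simp only [not_or, mem_setOf_eq, mem_compl_iff, mem_singleton_iff]

/-- **The explicit formula for `spinIsometry` off the axis**: for `a⃗ ≠ 0` with `a⃗/‖a⃗‖ ≠ e₃`,
`spinIsometry a⃗ y = S₁(y − 2 (⟪u, y⟫/‖u‖²) u)` with `u = a⃗/‖a⃗‖ − e₃` and `S₁` the reflection in
`e₁ᗮ` (`Submodule.reflection_singleton_apply`). [folklore] -/
theorem spinIsometry_apply_of_not {b : E3} (hb : ¬(b = 0 ∨ ‖b‖⁻¹ • b = axisVec)) (y : E3) :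
    spinIsometry b y = (ℝ ∙ sideVec)ᗮ.reflection
      (y - 2 • (⟪‖b‖⁻¹ • b - axisVec, y⟫ / ‖‖b‖⁻¹ • b - axisVec‖ ^ 2) •
        (‖b‖⁻¹ • b - axisVec)) := by
  unfold spinIsometry
  rw [if_neg hb]
  show (ℝ ∙ sideVec)ᗮ.reflection ((ℝ ∙ (‖b‖⁻¹ • b - axisVec))ᗮ.reflection y) = _
  congr 1
  rw [Submodule.reflection_orthogonal_apply, Submodule.reflection_singleton_apply]
  simp only [RCLike.ofReal_real_eq_id, id_eq, neg_sub]

/-- **`(a⃗, y) ↦ spinIsometry a⃗ y` is jointly smooth off the axis** (explicit formula).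
[folklore] -/
theorem contDiffOn_spinIsometry_apply :
    ContDiffOn ℝ ∞ (fun q : E3 × E3 ↦ spinIsometry q.1 q.2)
      ({b : E3 | ¬(b = 0 ∨ ‖b‖⁻¹ • b = axisVec)} ×ˢ univ) := by
  have hO : IsOpen ({b : E3 | ¬(b = 0 ∨ ‖b‖⁻¹ • b = axisVec)} ×ˢ (univ : Set E3)) :=
    isOpen_spinIsometry_good.prod isOpen_univ
  intro q hq
  refine ContDiffAt.contDiffWithinAt ?_
  have hq1 : ¬(q.1 = 0 ∨ ‖q.1‖⁻¹ • q.1 = axisVec) := hq.1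
  have hb : q.1 ≠ 0 := fun h ↦ hq1 (Or.inl h)
  have hu0 : ‖q.1‖⁻¹ • q.1 - axisVec ≠ 0 := fun h ↦ hq1 (Or.inr (sub_eq_zero.1 h))
  -- the explicit formula holds near `q`
  have hev : (fun q : E3 × E3 ↦ spinIsometry q.1 q.2) =ᶠ[𝓝 q] fun q ↦ (ℝ ∙ sideVec)ᗮ.reflection
      (q.2 - 2 • (⟪‖q.1‖⁻¹ • q.1 - axisVec, q.2⟫ / ‖‖q.1‖⁻¹ • q.1 - axisVec‖ ^ 2) •
        (‖q.1‖⁻¹ • q.1 - axisVec)) := by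
    filter_upwards [hO.mem_nhds hq] with q' hq'
    exact spinIsometry_apply_of_not hq'.1 q'.2
  refine ContDiffAt.congr_of_eventuallyEq ?_ hev
  have hu : ContDiffAt ℝ ∞ (fun q : E3 × E3 ↦ ‖q.1‖⁻¹ • q.1 - axisVec) q :=
    ((((contDiffAt_norm ℝ hb).comp q contDiffAt_fst).inv (norm_ne_zero_iff.2 hb)).smul
      contDiffAt_fst).sub contDiffAt_const
  have hi : ContDiffAt ℝ ∞ (fun q : E3 × E3 ↦ ⟪‖q.1‖⁻¹ • q.1 - axisVec, q.2⟫) q :=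
    hu.inner ℝ contDiffAt_snd
  have hn : ContDiffAt ℝ ∞ (fun q : E3 × E3 ↦ ‖‖q.1‖⁻¹ • q.1 - axisVec‖ ^ 2) q :=
    hu.norm_sq ℝ
  have hc : ContDiffAt ℝ ∞ (fun q : E3 × E3 ↦
      ⟪‖q.1‖⁻¹ • q.1 - axisVec, q.2⟫ / ‖‖q.1‖⁻¹ • q.1 - axisVec‖ ^ 2) q :=
    hi.div hn (by positivity)
  exact ((ℝ ∙ sideVec)ᗮ.reflection : E3 ≃ₗᵢ[ℝ] E3).toContinuousLinearEquiv.contDiff.contDiffAt.comp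
    q (contDiffAt_snd.sub ((hc.smul hu).const_smul _))

/-! ### A second chart of rotations, smooth across the positive axis -/

/-- **A second choice of rotation taking `a⃗/‖a⃗‖` to `e₃`**, smooth near the positive axis where
`spinIsometry` is not: the reflection taking `a⃗/‖a⃗‖` to `−e₃` followed by the reflection in
`e₃ᗮ`; the identity for `a⃗ = 0` or `a⃗/‖a⃗‖ = −e₃`. By the canonicity below both choices give the
same Kerr-cylinder data. [cite: LiMei2020, §4, p. 22] -/
def spinIsometry' (b : E3) : E3 →ₗᵢ[ℝ] E3 :=
  if b = 0 ∨ ‖b‖⁻¹ • b = -axisVec then LinearIsometry.id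
  else (((ℝ ∙ (‖b‖⁻¹ • b - -axisVec))ᗮ.reflection.trans
    (ℝ ∙ axisVec)ᗮ.reflection).toLinearIsometry)

/-- `spinIsometry' a⃗` maps `a⃗/‖a⃗‖` to `e₃` (`a⃗ ≠ 0`, `a⃗/‖a⃗‖ ≠ −e₃`). [folklore] -/
theorem spinIsometry'_apply_dir {b : E3} (hb : b ≠ 0) (hne : ‖b‖⁻¹ • b ≠ -axisVec) :
    spinIsometry' b (‖b‖⁻¹ • b) = axisVec := by
  unfold spinIsometry'
  rw [if_neg (not_or.2 ⟨hb, hne⟩)]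
  have hn : ‖‖b‖⁻¹ • b‖ = ‖-axisVec‖ := by
    rw [norm_smul, norm_inv, norm_norm, inv_mul_cancel₀ (norm_ne_zero_iff.2 hb), norm_neg,
      norm_axisVec]
  show (ℝ ∙ axisVec)ᗮ.reflection ((ℝ ∙ (‖b‖⁻¹ • b - -axisVec))ᗮ.reflection (‖b‖⁻¹ • b)) = axisVec
  rw [Submodule.reflection_sub hn, map_neg, Submodule.reflection_orthogonalComplement_singleton_eq_neg,
    neg_neg]

/-- The rotations `spinIsometry' a⃗` are orientation preserving. [folklore] -/
theorem det_spinIsometry' (b : E3) : LinearMap.det (spinIsometry' b).toLinearMap = 1 := by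
  unfold spinIsometry'
  split_ifs with h
  · exact LinearMap.det_id
  · have hv : ‖b‖⁻¹ • b - -axisVec ≠ 0 := fun hv ↦ h (Or.inr (sub_eq_zero.1 hv))
    have hs : axisVec ≠ 0 := by
      intro h0
      have := congrArg (fun v : E3 ↦ v 2) h0
      simp [axisVec] at this
    have hrank : ∀ {v : E3}, v ≠ 0 → Module.finrank ℝ (ℝ ∙ v)ᗮᗮ = 1 := fun {v} hv ↦ by
      rw [Submodule.orthogonal_orthogonal, finrank_span_singleton hv]
    show LinearMap.det (((ℝ ∙ (‖b‖⁻¹ • b - -axisVec))ᗮ.reflection.trans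
      (ℝ ∙ axisVec)ᗮ.reflection).toLinearIsometry).toLinearMap = 1
    have hcomp : (((ℝ ∙ (‖b‖⁻¹ • b - -axisVec))ᗮ.reflection.trans
        (ℝ ∙ axisVec)ᗮ.reflection).toLinearIsometry).toLinearMap =
        ((ℝ ∙ axisVec)ᗮ.reflection.toLinearEquiv : E3 →ₗ[ℝ] E3) ∘ₗ
          ((ℝ ∙ (‖b‖⁻¹ • b - -axisVec))ᗮ.reflection.toLinearEquiv : E3 →ₗ[ℝ] E3) := rfl
    rw [hcomp, LinearMap.det_comp]
    have h1 := (ℝ ∙ axisVec)ᗮ.det_reflection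
    have h2 := (ℝ ∙ (‖b‖⁻¹ • b - -axisVec))ᗮ.det_reflection
    rw [hrank hs] at h1
    rw [hrank hv] at h2
    rw [show ((ℝ ∙ axisVec)ᗮ.reflection.toLinearEquiv : E3 →ₗ[ℝ] E3) =
      (ℝ ∙ axisVec)ᗮ.reflection.toLinearMap from rfl, h1,
      show ((ℝ ∙ (‖b‖⁻¹ • b - -axisVec))ᗮ.reflection.toLinearEquiv : E3 →ₗ[ℝ] E3) =
      (ℝ ∙ (‖b‖⁻¹ • b - -axisVec))ᗮ.reflection.toLinearMap from rfl, h2]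
    norm_num

/-- The chart set of `spinIsometry'`: `a⃗ ≠ 0` not on the negative axis (open). [folklore] -/
theorem isOpen_spinIsometry'_good :
    IsOpen {b : E3 | ¬(b = 0 ∨ ‖b‖⁻¹ • b = -axisVec)} := by
  have h1 : IsOpen {b : E3 | b ≠ 0} := isOpen_ne
  have hc : ContinuousOn (fun b : E3 ↦ ‖b‖⁻¹ • b) {b : E3 | b ≠ 0} :=
    (continuous_norm.continuousOn.inv₀ fun b hb ↦ norm_ne_zero_iff.2 hb).smul continuousOn_id
  have h2 : IsOpen {b ∈ {b : E3 | b ≠ 0} | ‖b‖⁻¹ • b ∈ ({-axisVec}ᶜ : Set E3)} :=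
    hc.isOpen_inter_preimage h1 isOpen_compl_singleton
  convert h2 using 1
  ext b
  simp only [not_or, mem_setOf_eq, mem_compl_iff, mem_singleton_iff]

/-- The explicit formula for `spinIsometry'` on its chart set. [folklore] -/
theorem spinIsometry'_apply_of_not {b : E3} (hb : ¬(b = 0 ∨ ‖b‖⁻¹ • b = -axisVec)) (y : E3) :
    spinIsometry' b y = (ℝ ∙ axisVec)ᗮ.reflection
      (y - 2 • (⟪‖b‖⁻¹ • b - -axisVec, y⟫ / ‖‖b‖⁻¹ • b - -axisVec‖ ^ 2) •
        (‖b‖⁻¹ • b - -axisVec)) := by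
  unfold spinIsometry'
  rw [if_neg hb]
  show (ℝ ∙ axisVec)ᗮ.reflection ((ℝ ∙ (‖b‖⁻¹ • b - -axisVec))ᗮ.reflection y) = _
  congr 1
  rw [Submodule.reflection_orthogonal_apply, Submodule.reflection_singleton_apply]
  simp only [RCLike.ofReal_real_eq_id, id_eq, neg_sub]

/-- **`(a⃗, y) ↦ spinIsometry' a⃗ y` is jointly smooth on its chart set** (in particular across
the positive axis). [folklore] -/
theorem contDiffOn_spinIsometry'_apply :
    ContDiffOn ℝ ∞ (fun q : E3 × E3 ↦ spinIsometry' q.1 q.2)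
      ({b : E3 | ¬(b = 0 ∨ ‖b‖⁻¹ • b = -axisVec)} ×ˢ univ) := by
  have hO : IsOpen ({b : E3 | ¬(b = 0 ∨ ‖b‖⁻¹ • b = -axisVec)} ×ˢ (univ : Set E3)) :=
    isOpen_spinIsometry'_good.prod isOpen_univ
  intro q hq
  refine ContDiffAt.contDiffWithinAt ?_
  have hq1 : ¬(q.1 = 0 ∨ ‖q.1‖⁻¹ • q.1 = -axisVec) := hq.1
  have hb : q.1 ≠ 0 := fun h ↦ hq1 (Or.inl h)
  have hu0 : ‖q.1‖⁻¹ • q.1 - -axisVec ≠ 0 := fun h ↦ hq1 (Or.inr (sub_eq_zero.1 h))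
  have hev : (fun q : E3 × E3 ↦ spinIsometry' q.1 q.2) =ᶠ[𝓝 q] fun q ↦ (ℝ ∙ axisVec)ᗮ.reflection
      (q.2 - 2 • (⟪‖q.1‖⁻¹ • q.1 - -axisVec, q.2⟫ / ‖‖q.1‖⁻¹ • q.1 - -axisVec‖ ^ 2) •
        (‖q.1‖⁻¹ • q.1 - -axisVec)) := by
    filter_upwards [hO.mem_nhds hq] with q' hq'
    exact spinIsometry'_apply_of_not hq'.1 q'.2
  refine ContDiffAt.congr_of_eventuallyEq ?_ hev
  have hu : ContDiffAt ℝ ∞ (fun q : E3 × E3 ↦ ‖q.1‖⁻¹ • q.1 - -axisVec) q :=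
    ((((contDiffAt_norm ℝ hb).comp q contDiffAt_fst).inv (norm_ne_zero_iff.2 hb)).smul
      contDiffAt_fst).sub contDiffAt_const
  have hi : ContDiffAt ℝ ∞ (fun q : E3 × E3 ↦ ⟪‖q.1‖⁻¹ • q.1 - -axisVec, q.2⟫) q :=
    hu.inner ℝ contDiffAt_snd
  have hn : ContDiffAt ℝ ∞ (fun q : E3 × E3 ↦ ‖‖q.1‖⁻¹ • q.1 - -axisVec‖ ^ 2) q :=
    hu.norm_sq ℝ
  have hc : ContDiffAt ℝ ∞ (fun q : E3 × E3 ↦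
      ⟪‖q.1‖⁻¹ • q.1 - -axisVec, q.2⟫ / ‖‖q.1‖⁻¹ • q.1 - -axisVec‖ ^ 2) q :=
    hi.div hn (by positivity)
  exact ((ℝ ∙ axisVec)ᗮ.reflection : E3 ≃ₗᵢ[ℝ] E3).toContinuousLinearEquiv.contDiff.contDiffAt.comp
    q (contDiffAt_snd.sub ((hc.smul hu).const_smul _))

/-- **Canonicity of the four-parameter family**: two orientation-preserving linear isometries
`R, R'` of `E3` taking the same vector to the axis `e₃` give Kerr-cylinder data with the same
metric (Li–Mei p. 22: "this definition does not depend on the choice of `Ω_{a⃗}`").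
[cite: LiMei2020, §4, p. 22] -/
theorem kerrCylinderDatum_h_inner_eq_of_apply_eq [Kerr.Facts] {m a r₀ : ℝ} (ha : |a| < m)
    (h₁ : Kerr.rMinus m a < r₀) (h₂ : r₀ < Kerr.rPlus m a) (τ₀ : ℝ) {R R' : E3 →ₗᵢ[ℝ] E3} {n : E3}
    (hR : R n = EuclideanSpace.single 2 1) (hR' : R' n = EuclideanSpace.single 2 1)
    (hdR : LinearMap.det R.toLinearMap = 1) (hdR' : LinearMap.det R'.toLinearMap = 1) (y : E3) :
    (kerrCylinderDatum ha h₁ h₂ τ₀ R').h.inner y = (kerrCylinderDatum ha h₁ h₂ τ₀ R).h.inner y := by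
  obtain ⟨α, hα⟩ := E3.exists_eq_axialRot_comp hR hR' hdR hdR'
  rw [hα]
  exact kerrCylinderDatum_h_inner_axialRot ha h₁ h₂ τ₀ α R y

/-- **Canonicity of the four-parameter family** (second fundamental form).
[cite: LiMei2020, §4, p. 22] -/
theorem kerrCylinderDatum_k_eq_of_apply_eq [Kerr.Facts] {m a r₀ : ℝ} (ha : |a| < m)
    (h₁ : Kerr.rMinus m a < r₀) (h₂ : r₀ < Kerr.rPlus m a) (τ₀ : ℝ) {R R' : E3 →ₗᵢ[ℝ] E3} {n : E3}
    (hR : R n = EuclideanSpace.single 2 1) (hR' : R' n = EuclideanSpace.single 2 1)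
    (hdR : LinearMap.det R.toLinearMap = 1) (hdR' : LinearMap.det R'.toLinearMap = 1) (y : E3) :
    (kerrCylinderDatum ha h₁ h₂ τ₀ R').k y = (kerrCylinderDatum ha h₁ h₂ τ₀ R).k y := by
  obtain ⟨α, hα⟩ := E3.exists_eq_axialRot_comp hR hR' hdR hdR'
  rw [hα]
  exact kerrCylinderDatum_k_axialRot ha h₁ h₂ τ₀ α R y

/-- **The two charts give the same data**: for `a⃗ ≠ 0` off the negative axis,
`kerrCylinderDatum m a (spinIsometry' a⃗)` and `kerrCylinderDatum m a (spinIsometry a⃗)` have the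
same metric — so the family `a⃗ ↦ kerrCylinderDatum m ‖a⃗‖ (spinIsometry a⃗)` is smooth across the
positive axis as well (`contDiffOn_spinIsometry'_apply`). [cite: LiMei2020, §4, p. 22] -/
theorem kerrCylinderDatum_h_inner_spinIsometry' [Kerr.Facts] {m a r₀ : ℝ} (ha : |a| < m)
    (h₁ : Kerr.rMinus m a < r₀) (h₂ : r₀ < Kerr.rPlus m a) (τ₀ : ℝ) {b : E3} (hb : b ≠ 0)
    (hne : ‖b‖⁻¹ • b ≠ -axisVec) (y : E3) :
    (kerrCylinderDatum ha h₁ h₂ τ₀ (spinIsometry' b)).h.inner y =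
      (kerrCylinderDatum ha h₁ h₂ τ₀ (spinIsometry b)).h.inner y :=
  kerrCylinderDatum_h_inner_eq_of_apply_eq ha h₁ h₂ τ₀ (spinIsometry_apply_dir hb)
    (spinIsometry'_apply_dir hb hne) (det_spinIsometry b) (det_spinIsometry' b) y

/-- **The two charts give the same data** (second fundamental form). [cite: LiMei2020, §4, p. 22] -/
theorem kerrCylinderDatum_k_spinIsometry' [Kerr.Facts] {m a r₀ : ℝ} (ha : |a| < m)
    (h₁ : Kerr.rMinus m a < r₀) (h₂ : r₀ < Kerr.rPlus m a) (τ₀ : ℝ) {b : E3} (hb : b ≠ 0)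
    (hne : ‖b‖⁻¹ • b ≠ -axisVec) (y : E3) :
    (kerrCylinderDatum ha h₁ h₂ τ₀ (spinIsometry' b)).k y =
      (kerrCylinderDatum ha h₁ h₂ τ₀ (spinIsometry b)).k y :=
  kerrCylinderDatum_k_eq_of_apply_eq ha h₁ h₂ τ₀ (spinIsometry_apply_dir hb)
    (spinIsometry'_apply_dir hb hne) (det_spinIsometry b) (det_spinIsometry' b) y

/-! ### The rotations `spinIsometry a⃗` depend smoothly on `a⃗` off the axis ray -/

/-- Off `a⃗ = 0` and the ray `a⃗ ∥ e₃` (pointing up), `spinIsometry a⃗` is the explicit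
composition of the two reflections: `y ↦ S₀ (y − 2 (⟪u, y⟫/‖u‖²) u)` with `u = a⃗/‖a⃗‖ − e₃` and
`S₀` the reflection in `e₁ᗮ`. [folklore] -/
theorem spinIsometry_apply_of_ne {b : E3} (hb : b ≠ 0) (hax : ‖b‖⁻¹ • b ≠ axisVec) (y : E3) :
    spinIsometry b y = (ℝ ∙ sideVec)ᗮ.reflection
      (y - (2 * (⟪‖b‖⁻¹ • b - axisVec, y⟫ / ‖‖b‖⁻¹ • b - axisVec‖ ^ 2)) •
        (‖b‖⁻¹ • b - axisVec)) := by
  unfold spinIsometry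
  rw [if_neg (not_or.2 ⟨hb, hax⟩)]
  show (ℝ ∙ sideVec)ᗮ.reflection ((ℝ ∙ (‖b‖⁻¹ • b - axisVec))ᗮ.reflection y) = _
  congr 1
  rw [Submodule.reflection_orthogonal_apply, Submodule.reflection_singleton_apply]
  simp only [RCLike.ofReal_real_eq_id, id_eq, neg_sub]
  rw [two_smul, mul_smul, two_smul]

/-- **`a⃗ ↦ spinIsometry a⃗` is smooth off `a⃗ = 0` and the upward axis ray**, as a map into the
continuous linear maps (so the four-parameter family `kerrCylinderDatum m ‖a⃗‖ (spinIsometry a⃗)`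
is given there by a smooth chart of `SO(3)`; near the excluded ray use the canonicity
`kerrCylinderDatum_h_inner_eq_of_apply_eq` with another chart). [folklore] -/
theorem contDiffOn_spinIsometry :
    ContDiffOn ℝ ∞ (fun b : E3 ↦ (spinIsometry b).toContinuousLinearMap)
      {b : E3 | b ≠ 0 ∧ ‖b‖⁻¹ • b ≠ axisVec} := by
  have hO : IsOpen {b : E3 | b ≠ 0 ∧ ‖b‖⁻¹ • b ≠ axisVec} := by
    have hc : ContinuousOn (fun b : E3 ↦ ‖b‖⁻¹ • b) {b : E3 | b ≠ 0} :=
      ((continuousOn_id.norm).inv₀ fun b hb ↦ norm_ne_zero_iff.2 hb).smul continuousOn_id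
    exact hc.isOpen_inter_preimage isOpen_ne (isOpen_ne (x := axisVec))
  refine contDiffOn_clm_apply.2 fun y ↦ ?_
  have hu : ContDiffOn ℝ ∞ (fun b : E3 ↦ ‖b‖⁻¹ • b - axisVec) {b : E3 | b ≠ 0 ∧ ‖b‖⁻¹ • b ≠ axisVec} :=
    (((contDiffOn_id.norm ℝ fun b hb ↦ hb.1).inv fun b hb ↦ norm_ne_zero_iff.2 hb.1).smul
      contDiffOn_id).sub contDiffOn_const
  have hform : ContDiffOn ℝ ∞ (fun b : E3 ↦ (ℝ ∙ sideVec)ᗮ.reflection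
      (y - (2 * (⟪‖b‖⁻¹ • b - axisVec, y⟫ / ‖‖b‖⁻¹ • b - axisVec‖ ^ 2)) • (‖b‖⁻¹ • b - axisVec)))
      {b : E3 | b ≠ 0 ∧ ‖b‖⁻¹ • b ≠ axisVec} := by
    refine ((ℝ ∙ sideVec)ᗮ.reflection.toContinuousLinearEquiv.contDiff.comp_contDiffOn
      (contDiffOn_const.sub ?_))
    refine (contDiffOn_const.mul ((hu.inner ℝ contDiffOn_const).div (hu.norm_sq ℝ) fun b hb ↦ ?_)).smul hu
    exact pow_ne_zero 2 (norm_ne_zero_iff.2 (sub_ne_zero.2 hb.2))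
  refine hform.congr fun b hb ↦ ?_
  exact spinIsometry_apply_of_ne hb.1 hb.2 y

/-! ### A second chart, smooth across the upward ray -/

/-- **A second rotation taking `a⃗/‖a⃗‖` to `e₃`**, smooth near the upward axis ray where
`spinIsometry` is not: the reflection in the bisecting mirror of `a⃗/‖a⃗‖` and `−e₃` followed by
the reflection in `e₃ᗮ` (two reflections); the rotation by `π` about `e₁` when `a⃗ = 0` or
`a⃗/‖a⃗‖ = −e₃`. [folklore] -/
def spinIsometry₂ (b : E3) : E3 →ₗᵢ[ℝ] E3 :=
  if b = 0 ∨ ‖b‖⁻¹ • b = -axisVec then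
    ((ℝ ∙ sideVec2)ᗮ.reflection.trans (ℝ ∙ axisVec)ᗮ.reflection).toLinearIsometry
  else ((ℝ ∙ (‖b‖⁻¹ • b + axisVec))ᗮ.reflection.trans (ℝ ∙ axisVec)ᗮ.reflection).toLinearIsometry
  where
  /-- The auxiliary direction `e₂ = (0, 1, 0)`. [folklore] -/
  sideVec2 : E3 := EuclideanSpace.single 1 1

/-- **`spinIsometry₂ a⃗` maps the direction `a⃗/‖a⃗‖` to the axis `e₃`** (`a⃗ ≠ 0`). [folklore] -/
theorem spinIsometry₂_apply_dir {b : E3} (hb : b ≠ 0) : spinIsometry₂ b (‖b‖⁻¹ • b) = axisVec := by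
  have hax3 : (ℝ ∙ axisVec)ᗮ.reflection (-axisVec) = axisVec := by
    rw [map_neg, Submodule.reflection_orthogonalComplement_singleton_eq_neg, neg_neg]
  unfold spinIsometry₂
  by_cases hax : ‖b‖⁻¹ • b = -axisVec
  · rw [if_pos (Or.inr hax), hax]
    show (ℝ ∙ axisVec)ᗮ.reflection ((ℝ ∙ spinIsometry₂.sideVec2)ᗮ.reflection (-axisVec)) = axisVec
    have hmem : -axisVec ∈ (ℝ ∙ spinIsometry₂.sideVec2)ᗮ := by
      refine (Submodule.mem_orthogonal_singleton_iff_inner_right).2 ?_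
      simp [spinIsometry₂.sideVec2, axisVec, EuclideanSpace.inner_single_left]
    rw [Submodule.reflection_mem_subspace_eq_self hmem, hax3]
  · rw [if_neg (not_or.2 ⟨hb, hax⟩)]
    have hn : ‖‖b‖⁻¹ • b‖ = ‖-axisVec‖ := by
      rw [norm_smul, norm_inv, norm_norm, inv_mul_cancel₀ (norm_ne_zero_iff.2 hb), norm_neg,
        norm_axisVec]
    show (ℝ ∙ axisVec)ᗮ.reflection ((ℝ ∙ (‖b‖⁻¹ • b + axisVec))ᗮ.reflection (‖b‖⁻¹ • b)) = axisVec
    rw [show ‖b‖⁻¹ • b + axisVec = ‖b‖⁻¹ • b - -axisVec from (sub_neg_eq_add _ _).symm,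
      Submodule.reflection_sub hn, hax3]

/-- **The rotations `spinIsometry₂ a⃗` are orientation preserving** (two reflections in either
case). [folklore] -/
theorem det_spinIsometry₂ (b : E3) : LinearMap.det (spinIsometry₂ b).toLinearMap = 1 := by
  have hrank : ∀ {v : E3}, v ≠ 0 → Module.finrank ℝ (ℝ ∙ v)ᗮᗮ = 1 := fun {v} hv ↦ by
    rw [Submodule.orthogonal_orthogonal, finrank_span_singleton hv]
  have hax0 : axisVec ≠ 0 := by
    intro h0
    have := congrArg (fun v : E3 ↦ v 2) h0
    simp [axisVec] at this
  -- determinant of a composition of two hyperplane reflections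
  have key : ∀ {u : E3}, u ≠ 0 → LinearMap.det (((ℝ ∙ u)ᗮ.reflection.trans
      (ℝ ∙ axisVec)ᗮ.reflection).toLinearIsometry).toLinearMap = 1 := by
    intro u hu
    have hcomp : (((ℝ ∙ u)ᗮ.reflection.trans (ℝ ∙ axisVec)ᗮ.reflection).toLinearIsometry).toLinearMap =
        ((ℝ ∙ axisVec)ᗮ.reflection.toLinearEquiv : E3 →ₗ[ℝ] E3) ∘ₗ
          ((ℝ ∙ u)ᗮ.reflection.toLinearEquiv : E3 →ₗ[ℝ] E3) := rfl
    rw [hcomp, LinearMap.det_comp]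
    have h1 := (ℝ ∙ axisVec)ᗮ.det_reflection
    have h2 := (ℝ ∙ u)ᗮ.det_reflection
    rw [hrank hax0] at h1
    rw [hrank hu] at h2
    rw [show ((ℝ ∙ axisVec)ᗮ.reflection.toLinearEquiv : E3 →ₗ[ℝ] E3) =
      (ℝ ∙ axisVec)ᗮ.reflection.toLinearMap from rfl, h1,
      show ((ℝ ∙ u)ᗮ.reflection.toLinearEquiv : E3 →ₗ[ℝ] E3) =
      (ℝ ∙ u)ᗮ.reflection.toLinearMap from rfl, h2]
    norm_num
  unfold spinIsometry₂
  split_ifs with h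
  · refine key ?_
    intro h0
    have := congrArg (fun v : E3 ↦ v 1) h0
    simp [spinIsometry₂.sideVec2] at this
  · refine key fun h0 ↦ h (Or.inr ?_)
    exact (eq_neg_iff_add_eq_zero).2 h0

/-- Off `a⃗ = 0` and the downward axis ray, `spinIsometry₂ a⃗` is the explicit composition of the
two reflections. [folklore] -/
theorem spinIsometry₂_apply_of_ne {b : E3} (hb : b ≠ 0) (hax : ‖b‖⁻¹ • b ≠ -axisVec) (y : E3) :
    spinIsometry₂ b y = (ℝ ∙ axisVec)ᗮ.reflection
      (y - (2 * (⟪‖b‖⁻¹ • b + axisVec, y⟫ / ‖‖b‖⁻¹ • b + axisVec‖ ^ 2)) •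
        (‖b‖⁻¹ • b + axisVec)) := by
  unfold spinIsometry₂
  rw [if_neg (not_or.2 ⟨hb, hax⟩)]
  show (ℝ ∙ axisVec)ᗮ.reflection ((ℝ ∙ (‖b‖⁻¹ • b + axisVec))ᗮ.reflection y) = _
  congr 1
  rw [Submodule.reflection_orthogonal_apply, Submodule.reflection_singleton_apply]
  simp only [RCLike.ofReal_real_eq_id, id_eq, neg_sub]
  rw [two_smul, mul_smul, two_smul]

/-- **`a⃗ ↦ spinIsometry₂ a⃗` is smooth off `a⃗ = 0` and the downward axis ray.** [folklore] -/
theorem contDiffOn_spinIsometry₂ :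
    ContDiffOn ℝ ∞ (fun b : E3 ↦ (spinIsometry₂ b).toContinuousLinearMap)
      {b : E3 | b ≠ 0 ∧ ‖b‖⁻¹ • b ≠ -axisVec} := by
  refine contDiffOn_clm_apply.2 fun y ↦ ?_
  have hu : ContDiffOn ℝ ∞ (fun b : E3 ↦ ‖b‖⁻¹ • b + axisVec)
      {b : E3 | b ≠ 0 ∧ ‖b‖⁻¹ • b ≠ -axisVec} :=
    (((contDiffOn_id.norm ℝ fun b hb ↦ hb.1).inv fun b hb ↦ norm_ne_zero_iff.2 hb.1).smul
      contDiffOn_id).add contDiffOn_const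
  have hne : ∀ b ∈ {b : E3 | b ≠ 0 ∧ ‖b‖⁻¹ • b ≠ -axisVec}, ‖b‖⁻¹ • b + axisVec ≠ 0 :=
    fun b hb h0 ↦ hb.2 ((eq_neg_iff_add_eq_zero).2 h0)
  have hform : ContDiffOn ℝ ∞ (fun b : E3 ↦ (ℝ ∙ axisVec)ᗮ.reflection
      (y - (2 * (⟪‖b‖⁻¹ • b + axisVec, y⟫ / ‖‖b‖⁻¹ • b + axisVec‖ ^ 2)) • (‖b‖⁻¹ • b + axisVec)))
      {b : E3 | b ≠ 0 ∧ ‖b‖⁻¹ • b ≠ -axisVec} := by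
    refine ((ℝ ∙ axisVec)ᗮ.reflection.toContinuousLinearEquiv.contDiff.comp_contDiffOn
      (contDiffOn_const.sub ?_))
    refine (contDiffOn_const.mul ((hu.inner ℝ contDiffOn_const).div (hu.norm_sq ℝ)
      fun b hb ↦ ?_)).smul hu
    exact pow_ne_zero 2 (norm_ne_zero_iff.2 (hne b hb))
  refine hform.congr fun b hb ↦ ?_
  exact spinIsometry₂_apply_of_ne hb.1 hb.2 y

/-- **Chart independence of the four-parameter family**: the two charts give the same
Kerr-cylinder metric (`a⃗ ≠ 0`) — Li–Mei's "does not depend on the choice of `Ω_{a⃗}`".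
[cite: LiMei2020, §4, p. 22] -/
theorem kerrCylinderDatum_h_inner_spinIsometry₂ [Kerr.Facts] {m r₀ : ℝ} {b : E3} (hb : b ≠ 0)
    (ha : |‖b‖| < m) (h₁ : Kerr.rMinus m ‖b‖ < r₀) (h₂ : r₀ < Kerr.rPlus m ‖b‖) (τ₀ : ℝ) (y : E3) :
    (kerrCylinderDatum ha h₁ h₂ τ₀ (spinIsometry₂ b)).h.inner y =
      (kerrCylinderDatum ha h₁ h₂ τ₀ (spinIsometry b)).h.inner y :=
  kerrCylinderDatum_h_inner_eq_of_apply_eq ha h₁ h₂ τ₀ (spinIsometry_apply_dir hb)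
    (spinIsometry₂_apply_dir hb) (det_spinIsometry b) (det_spinIsometry₂ b) y

/-- **Chart independence of the four-parameter family** (second fundamental form).
[cite: LiMei2020, §4, p. 22] -/
theorem kerrCylinderDatum_k_spinIsometry₂ [Kerr.Facts] {m r₀ : ℝ} {b : E3} (hb : b ≠ 0)
    (ha : |‖b‖| < m) (h₁ : Kerr.rMinus m ‖b‖ < r₀) (h₂ : r₀ < Kerr.rPlus m ‖b‖) (τ₀ : ℝ) (y : E3) :
    (kerrCylinderDatum ha h₁ h₂ τ₀ (spinIsometry₂ b)).k y =
      (kerrCylinderDatum ha h₁ h₂ τ₀ (spinIsometry b)).k y :=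
  kerrCylinderDatum_k_eq_of_apply_eq ha h₁ h₂ τ₀ (spinIsometry_apply_dir hb)
    (spinIsometry₂_apply_dir hb) (det_spinIsometry b) (det_spinIsometry₂ b) y

/-! ### The first-order spin term for a rotated axis -/

/-- **Li–Mei (4.2), metric part, for the rotated cylinder**: for every linear isometry `R`,
`∂_a|_{a=0} H₀[m, a, R](y)(v, w)` is the axis-`e₃` first-order term
(`hasDerivAt_cylH₀_spin`) read at `(Ry, Rv, Rw)` — by `cylH₀_isometry`; with `‖Ry‖ = ‖y‖`,
`⟪Ry, Rw⟫ = ⟪y, w⟫`. [cite: LiMei2020, (4.2)] -/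
theorem hasDerivAt_cylH₀_spin_isometry (m : ℝ) {r₀ : ℝ} (hr₀ : 0 < r₀) (τ₀ : ℝ)
    (R : E3 →ₗᵢ[ℝ] E3) {y : E3} (hy : y ≠ 0) (v w : E3) :
    HasDerivAt (fun a : ℝ ↦ cylH₀ m a r₀ τ₀ R y v w)
      (2 * m / (r₀ * ‖y‖ ^ 3) * ((R y 1 * R v 0 - R y 0 * R v 1) * ⟪y, w⟫ +
        ⟪y, v⟫ * (R y 1 * R w 0 - R y 0 * R w 1))) 0 := by
  have e : (fun a : ℝ ↦ cylH₀ m a r₀ τ₀ R y v w) =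
      fun a : ℝ ↦ cylH₀ m a r₀ τ₀ LinearIsometry.id (R y) (R v) (R w) :=
    funext fun a ↦ cylH₀_isometry m a r₀ τ₀ R y v w
  rw [e]
  have h := hasDerivAt_cylH₀_spin m hr₀ τ₀ (isometry_apply_ne_zero R hy) (R v) (R w)
  rw [LinearIsometry.norm_map, LinearIsometry.inner_map_map, LinearIsometry.inner_map_map] at h
  exact h

end LiMei

end Literature.Geometry.Lorentzian

end
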